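import Summits.PneNP.PneNP.Theorems.NegLimitedAmplifiedWindowBiasSeq
import Mathlib
import HarnessLib

/-!
# Amplified critical window — stub A, sub-helper (c₂): restriction moments of the recursive majority
(cell pnp-ideate, rung F-N1/p3, ROUND-11; line `amplified-window` on item stmt-PneNP-19860, stub A
`MonotoneAmplification`; card HOME/pnp-ideate-p3/r11/amplified-window.md §6 (c))

Random restrictions `ρ` of the `3^d` leaves of `RM3_d` (`Fin d → Fin 3`): each leaf independently FREE
with probability `η`, else FIXED to a fair bit (weight `rwt η ρ`).  The (recursively computed) bias
`rbias d ρ ∈ [-1, 1]` of `RM3_d` under `ρ` (leaf: `0` if free, `±1` if fixed; node: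
`(b₀+b₁+b₂ − b₀b₁b₂)/2`, the bias of the majority of three INDEPENDENT `±1` bits with biases `bᵢ`).

* `rwt_rflip`, `rbias_rflip` — flipping all fixed bits preserves the weight and negates the bias,
  hence all ODD moments vanish (`rmoment_odd`);
* `sum_rwt` — total weight `1` (`rwt_nonneg` — the weight is nonnegative for `η ∈ [0,1]`);
* `qMoment_succ` — the second moment obeys `q_{d+1} = (3 q_d + q_d³)/4` (split `ρ` into the three
  subtree restrictions, expand `((b₀+b₁+b₂−b₀b₁b₂)/2)²` into monomials, factor each monomial sum into
  a product of one-variable moments), so `qMoment η d = biasSeq η d` (`qMoment_eq_biasSeq`);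
* `sum_rwt_mul_abs_rbias_le` — `E|bias| ≤ √q_d` (Cauchy–Schwarz), the quantity O'Donnell's hybrid
  argument consumes.

[R. O'Donnell, *Hardness amplification within NP*, JCSS 69 (2004), §3; cell ROUND-11 §B.1 (A)]

HONEST FRAMING: elementary combinatorics for the OPEN stub A; nothing here bears on P vs NP.
-/

set_option linter.dupNamespace false -- `Summit.PneNP.PneNP.…`: summit = sub-problem name (D-0017 single-conjunct layout)

namespace Summit.PneNP.PneNP.Theorems.NegLimitedAmplifiedWindow

open Finset

/-- Restrictions of the `3^d` leaves: `none` = free leaf, `some b` = leaf fixed to `b`. -/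
abbrev Restr (d : ℕ) : Type := (Fin d → Fin 3) → Option Bool

/-- The one-leaf weight: `η` for a free leaf, `(1 − η)/2` for each fixed value. -/
noncomputable def leafWt (η : ℝ) (o : Option Bool) : ℝ := o.elim η (fun _ => (1 - η) / 2)

/-- The product weight of a restriction. -/
noncomputable def rwt (η : ℝ) {d : ℕ} (ρ : Restr d) : ℝ := ∏ w, leafWt η (ρ w)

/-- The recursively computed bias of `RM3_d` under the restriction `ρ` (`±1` convention, `+1` = true):
leaf `0 / ±1`, node `(b₀ + b₁ + b₂ − b₀ b₁ b₂)/2`. -/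
noncomputable def rbias : (d : ℕ) → Restr d → ℝ
  | 0, ρ => (ρ default).elim 0 (fun b => if b then 1 else -1)
  | d + 1, ρ =>
      (rbias d (fun w => ρ (Fin.cons 0 w)) + rbias d (fun w => ρ (Fin.cons 1 w)) +
          rbias d (fun w => ρ (Fin.cons 2 w)) -
        rbias d (fun w => ρ (Fin.cons 0 w)) * rbias d (fun w => ρ (Fin.cons 1 w)) *
          rbias d (fun w => ρ (Fin.cons 2 w))) / 2

/-- The `j`-th moment `Σ_ρ rwt(ρ)·rbias(ρ)^j`. -/
noncomputable def rmoment (η : ℝ) (d j : ℕ) : ℝ := ∑ ρ : Restr d, rwt η ρ * rbias d ρ ^ j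

/-- The second moment `q_d`. -/
noncomputable def qMoment (η : ℝ) (d : ℕ) : ℝ := rmoment η d 2

/-! ### Flip symmetry: odd moments vanish -/

/-- Flip every fixed bit. -/
def rflip {d : ℕ} (ρ : Restr d) : Restr d := fun w => (ρ w).map (fun b => !b)

/-- `rflip` is an involution. -/
theorem rflip_rflip {d : ℕ} (ρ : Restr d) : rflip (rflip ρ) = ρ := by
  funext w
  simp only [rflip, Option.map_map]
  cases ρ w <;> simp

/-- The weight is flip-invariant. -/
theorem rwt_rflip (η : ℝ) {d : ℕ} (ρ : Restr d) : rwt η (rflip ρ) = rwt η ρ := by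
  unfold rwt
  refine prod_congr rfl fun w _ => ?_
  simp only [rflip, leafWt]
  cases ρ w <;> simp

/-- The bias is flip-odd. -/
theorem rbias_rflip : ∀ (d : ℕ) (ρ : Restr d), rbias d (rflip ρ) = -rbias d ρ
  | 0, ρ => by
    simp only [rbias, rflip]
    rcases ρ default with _ | b
    · simp
    · cases b <;> simp
  | d + 1, ρ => by
    simp only [rbias]
    have h : ∀ i : Fin 3, rbias d (fun w => rflip ρ (Fin.cons i w)) = -rbias d (fun w => ρ (Fin.cons i w)) :=
      fun i => rbias_rflip d (fun w => ρ (Fin.cons i w))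
    rw [h 0, h 1, h 2]
    ring

/-- Odd moments vanish. -/
theorem rmoment_odd (η : ℝ) (d j : ℕ) : rmoment η d (2 * j + 1) = 0 := by
  unfold rmoment
  have hinv : Function.Involutive (rflip (d := d)) := rflip_rflip
  have h := Fintype.sum_equiv hinv.toPerm
    (fun ρ => rwt η (rflip ρ) * rbias d (rflip ρ) ^ (2 * j + 1))
    (fun ρ => rwt η ρ * rbias d ρ ^ (2 * j + 1)) (fun ρ => rfl)
  have hneg : ∀ ρ : Restr d, rwt η (rflip ρ) * rbias d (rflip ρ) ^ (2 * j + 1) =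
      -(rwt η ρ * rbias d ρ ^ (2 * j + 1)) := by
    intro ρ
    rw [rwt_rflip, rbias_rflip, Odd.neg_pow ⟨j, rfl⟩]
    ring
  simp only [hneg, sum_neg_distrib] at h
  linarith

/-! ### Total weight -/

/-- One leaf has total weight `1`. -/
theorem sum_leafWt (η : ℝ) : ∑ o : Option Bool, leafWt η o = 1 := by
  rw [Fintype.sum_option]
  simp [leafWt]
  ring

/-- Total weight `Σ_ρ rwt(ρ) = 1`. -/
theorem sum_rwt (η : ℝ) (d : ℕ) : ∑ ρ : Restr d, rwt η ρ = 1 := by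
  classical
  unfold rwt
  have h := (Finset.prod_univ_sum (fun _ : Fin d → Fin 3 => (univ : Finset (Option Bool)))
    (fun _ o => leafWt η o))
  rw [Fintype.piFinset_univ] at h
  rw [← h]
  simp_rw [sum_leafWt η]
  exact Finset.prod_const_one

/-- The zeroth moment is `1`. -/
theorem rmoment_zero (η : ℝ) (d : ℕ) : rmoment η d 0 = 1 := by
  simp [rmoment, sum_rwt]

/-! ### The second-moment recursion -/

/-- Splitting a restriction of `RM3_{d+1}` into its three subtree restrictions. -/
def rsplit {d : ℕ} (ρ : Restr (d + 1)) : Fin 3 → Restr d := fun i w => ρ (Fin.cons i w)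

/-- `rsplit` as an equivalence. -/
def rsplitEquiv (d : ℕ) : Restr (d + 1) ≃ (Fin 3 → Restr d) where
  toFun := rsplit
  invFun σ := fun v => σ (v 0) (Fin.tail v)
  left_inv ρ := by
    funext v
    simp only [rsplit, Fin.cons_self_tail]
  right_inv σ := by
    funext i w
    simp only [rsplit, Fin.cons_zero, Fin.tail_cons]

/-- The weight factors over the subtrees. -/
theorem rwt_succ (η : ℝ) {d : ℕ} (ρ : Restr (d + 1)) : rwt η ρ = ∏ i : Fin 3, rwt η (rsplit ρ i) := by
  unfold rwt rsplit
  rw [← Fintype.prod_prod_type' (f := fun i w => leafWt η (ρ (Fin.cons i w)))]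
  exact (Fintype.prod_equiv (Fin.consEquiv fun _ => Fin 3) _ _ fun p => rfl).symm

/-- Product sums over `Fin 3 → Restr d` factor into one-variable sums. -/
theorem sum_prod_three {d : ℕ} (f0 f1 f2 : Restr d → ℝ) :
    ∑ σ : Fin 3 → Restr d, f0 (σ 0) * f1 (σ 1) * f2 (σ 2) =
      (∑ ρ, f0 ρ) * (∑ ρ, f1 ρ) * (∑ ρ, f2 ρ) := by
  classical
  have h := (Finset.prod_univ_sum (fun _ : Fin 3 => (univ : Finset (Restr d)))
    (fun i ρ => (![f0, f1, f2] : Fin 3 → Restr d → ℝ) i ρ))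
  rw [Fintype.piFinset_univ, Fin.prod_univ_three] at h
  simp only [Matrix.cons_val_zero, Matrix.cons_val_one, Matrix.cons_val_two, Matrix.head_cons,
    Matrix.tail_cons] at h
  rw [h]
  refine sum_congr rfl fun σ _ => ?_
  rw [Fin.prod_univ_three]
  simp only [Matrix.cons_val_zero, Matrix.cons_val_one, Matrix.cons_val_two, Matrix.head_cons,
    Matrix.tail_cons]

/-- **The recursion `q_{d+1} = (3 q_d + q_d³)/4`.** -/
theorem qMoment_succ (η : ℝ) (d : ℕ) : qMoment η (d + 1) = (3 * qMoment η d + qMoment η d ^ 3) / 4 := by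
  classical
  have hM0 := rmoment_zero η d
  have hM1 : rmoment η d 1 = 0 := by simpa using rmoment_odd η d 0
  unfold qMoment rmoment at *
  -- pass to the three subtree restrictions
  rw [← Fintype.sum_equiv (rsplitEquiv d).symm (fun σ => rwt η ((rsplitEquiv d).symm σ) *
      rbias (d + 1) ((rsplitEquiv d).symm σ) ^ 2) _ (fun σ => rfl)]
  -- pointwise expansion into monomials
  have hpt : ∀ σ : Fin 3 → Restr d,
      rwt η ((rsplitEquiv d).symm σ) * rbias (d + 1) ((rsplitEquiv d).symm σ) ^ 2 =
      (1 / 4) * (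
        (rwt η (σ 0) * rbias d (σ 0) ^ 2) * (rwt η (σ 1) * rbias d (σ 1) ^ 0) * (rwt η (σ 2) * rbias d (σ 2) ^ 0) +
        (rwt η (σ 0) * rbias d (σ 0) ^ 0) * (rwt η (σ 1) * rbias d (σ 1) ^ 2) * (rwt η (σ 2) * rbias d (σ 2) ^ 0) +
        (rwt η (σ 0) * rbias d (σ 0) ^ 0) * (rwt η (σ 1) * rbias d (σ 1) ^ 0) * (rwt η (σ 2) * rbias d (σ 2) ^ 2) +
        2 * ((rwt η (σ 0) * rbias d (σ 0) ^ 1) * (rwt η (σ 1) * rbias d (σ 1) ^ 1) * (rwt η (σ 2) * rbias d (σ 2) ^ 0)) +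
        2 * ((rwt η (σ 0) * rbias d (σ 0) ^ 1) * (rwt η (σ 1) * rbias d (σ 1) ^ 0) * (rwt η (σ 2) * rbias d (σ 2) ^ 1)) +
        2 * ((rwt η (σ 0) * rbias d (σ 0) ^ 0) * (rwt η (σ 1) * rbias d (σ 1) ^ 1) * (rwt η (σ 2) * rbias d (σ 2) ^ 1)) -
        2 * ((rwt η (σ 0) * rbias d (σ 0) ^ 2) * (rwt η (σ 1) * rbias d (σ 1) ^ 1) * (rwt η (σ 2) * rbias d (σ 2) ^ 1)) -
        2 * ((rwt η (σ 0) * rbias d (σ 0) ^ 1) * (rwt η (σ 1) * rbias d (σ 1) ^ 2) * (rwt η (σ 2) * rbias d (σ 2) ^ 1)) -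
        2 * ((rwt η (σ 0) * rbias d (σ 0) ^ 1) * (rwt η (σ 1) * rbias d (σ 1) ^ 1) * (rwt η (σ 2) * rbias d (σ 2) ^ 2)) +
        (rwt η (σ 0) * rbias d (σ 0) ^ 2) * (rwt η (σ 1) * rbias d (σ 1) ^ 2) * (rwt η (σ 2) * rbias d (σ 2) ^ 2)) := by
    intro σ
    have hw : rwt η ((rsplitEquiv d).symm σ) = rwt η (σ 0) * rwt η (σ 1) * rwt η (σ 2) := by
      rw [rwt_succ, Fin.prod_univ_three]
      have : rsplit ((rsplitEquiv d).symm σ) = σ := (rsplitEquiv d).apply_symm_apply σ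
      rw [show rsplit ((rsplitEquiv d).symm σ) = σ from this]
    have hb : rbias (d + 1) ((rsplitEquiv d).symm σ) =
        (rbias d (σ 0) + rbias d (σ 1) + rbias d (σ 2) - rbias d (σ 0) * rbias d (σ 1) * rbias d (σ 2)) / 2 := by
      have h3 : ∀ i : Fin 3, (fun w => ((rsplitEquiv d).symm σ) (Fin.cons i w)) = σ i := by
        intro i
        have := congrFun ((rsplitEquiv d).apply_symm_apply σ) i
        exact this
      simp only [rbias]
      rw [h3 0, h3 1, h3 2]
    rw [hw, hb]
    ring
  rw [Fintype.sum_congr _ _ hpt, ← mul_sum]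
  simp only [sum_add_distrib, sum_sub_distrib, ← mul_sum]
  rw [sum_prod_three (fun ρ => rwt η ρ * rbias d ρ ^ 2) (fun ρ => rwt η ρ * rbias d ρ ^ 0)
      (fun ρ => rwt η ρ * rbias d ρ ^ 0),
    sum_prod_three (fun ρ => rwt η ρ * rbias d ρ ^ 0) (fun ρ => rwt η ρ * rbias d ρ ^ 2)
      (fun ρ => rwt η ρ * rbias d ρ ^ 0),
    sum_prod_three (fun ρ => rwt η ρ * rbias d ρ ^ 0) (fun ρ => rwt η ρ * rbias d ρ ^ 0)
      (fun ρ => rwt η ρ * rbias d ρ ^ 2),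
    sum_prod_three (fun ρ => rwt η ρ * rbias d ρ ^ 1) (fun ρ => rwt η ρ * rbias d ρ ^ 1)
      (fun ρ => rwt η ρ * rbias d ρ ^ 0),
    sum_prod_three (fun ρ => rwt η ρ * rbias d ρ ^ 1) (fun ρ => rwt η ρ * rbias d ρ ^ 0)
      (fun ρ => rwt η ρ * rbias d ρ ^ 1),
    sum_prod_three (fun ρ => rwt η ρ * rbias d ρ ^ 0) (fun ρ => rwt η ρ * rbias d ρ ^ 1)
      (fun ρ => rwt η ρ * rbias d ρ ^ 1),
    sum_prod_three (fun ρ => rwt η ρ * rbias d ρ ^ 2) (fun ρ => rwt η ρ * rbias d ρ ^ 1)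
      (fun ρ => rwt η ρ * rbias d ρ ^ 1),
    sum_prod_three (fun ρ => rwt η ρ * rbias d ρ ^ 1) (fun ρ => rwt η ρ * rbias d ρ ^ 2)
      (fun ρ => rwt η ρ * rbias d ρ ^ 1),
    sum_prod_three (fun ρ => rwt η ρ * rbias d ρ ^ 1) (fun ρ => rwt η ρ * rbias d ρ ^ 1)
      (fun ρ => rwt η ρ * rbias d ρ ^ 2),
    sum_prod_three (fun ρ => rwt η ρ * rbias d ρ ^ 2) (fun ρ => rwt η ρ * rbias d ρ ^ 2)
      (fun ρ => rwt η ρ * rbias d ρ ^ 2)]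
  rw [hM0, hM1]
  ring

/-- **`q_d = biasSeq η d`**: the restriction second moment is O'Donnell's sequence. -/
theorem qMoment_eq_biasSeq (η : ℝ) : ∀ d, qMoment η d = biasSeq η d
  | 0 => by
    classical
    unfold qMoment rmoment
    -- `Restr 0` has one leaf: sum over `Option Bool`
    rw [Fintype.sum_equiv (Equiv.funUnique (Fin 0 → Fin 3) (Option Bool)) _
      (fun o => leafWt η o * (o.elim 0 (fun b => if b then (1 : ℝ) else -1)) ^ 2)
      (fun ρ => by
        obtain ⟨o, ho⟩ : ∃ o, ∀ u, ρ u = o :=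
          ⟨ρ default, fun u => congrArg ρ (Subsingleton.elim _ _)⟩
        simp [rwt, rbias, ho]),
      Fintype.sum_option, biasSeq_zero]
    simp [leafWt]
    ring
  | d + 1 => by rw [qMoment_succ, qMoment_eq_biasSeq η d, biasSeq_succ]

/-- The restriction weight is nonnegative for `η ∈ [0,1]`. -/
theorem rwt_nonneg {η : ℝ} (hη0 : 0 ≤ η) (hη1 : η ≤ 1) {d : ℕ} (ρ : Restr d) : 0 ≤ rwt η ρ :=
  prod_nonneg fun w _ => by
    unfold leafWt
    cases ρ w <;> simp <;> linarith

/-- **`E|bias| ≤ √q_d`** (Cauchy–Schwarz against the probability weight `rwt`), for `η ∈ [0,1]`. -/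
theorem sum_rwt_mul_abs_rbias_le {η : ℝ} (hη0 : 0 ≤ η) (hη1 : η ≤ 1) (d : ℕ) :
    ∑ ρ : Restr d, rwt η ρ * |rbias d ρ| ≤ Real.sqrt (qMoment η d) := by
  have hw0 : ∀ ρ : Restr d, 0 ≤ rwt η ρ := fun ρ => rwt_nonneg hη0 hη1 ρ
  have hsq : (∑ ρ : Restr d, rwt η ρ * |rbias d ρ|) ^ 2 ≤
      (∑ ρ : Restr d, rwt η ρ) * ∑ ρ : Restr d, rwt η ρ * rbias d ρ ^ 2 := by
    refine sum_sq_le_sum_mul_sum_of_sq_le_mul univ (fun ρ _ => hw0 ρ)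
      (fun ρ _ => mul_nonneg (hw0 ρ) (sq_nonneg _)) fun ρ _ => le_of_eq ?_
    rw [mul_pow, sq_abs]
    ring
  rw [sum_rwt, one_mul] at hsq
  exact (le_abs_self _).trans (Real.abs_le_sqrt hsq)

end Summit.PneNP.PneNP.Theorems.NegLimitedAmplifiedWindow
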